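import Literature.NumberTheory.LFunctions.ClassGroupLFunctionLocalL0
import Literature.NumberTheory.LFunctions.LogFreeDensityLemmaA
import HarnessLib

/-!
# Bombieri's Lemme A for the class group `L`-functions of a number field

Topic `Literature/NumberTheory/LFunctions`, namespace `Literature.NumberTheory.LFunctions.NumberField`.
Everything here is PROVED (one definition with body, theorems; no named facts).

For a number field `K` of degree `n` and a class group character `χ ≠ 1` we feed the tree's abstract
Lemme A (`LogFreeDensity.lemmeA_abstract`, Bombieri, *Le grand crible*, §6, Lemme A) with the local
data of the entire `L₀(s, χ)` (`ClassGroupLFunctionLocalL0`): with the height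
`ℒ' = lemmaAHeight K v = (77760(5n+2) + 217440) · discBound K v`,

* `localCount_classGroupLFunction₀_le` — Lemme de densité: `Σ_{|ρ−(1+iv)| ≤ λ} m(ρ) ≤ 4(1 + λℒ')`
  (`0 < λ ≤ 1/4`);
* `lemmeA_classGroup₀` — **Lemme A**: there is an absolute `c₄ > 0` such that for every `K`, `χ ≠ 1`
  with `L₀(s, χ) ≠ 0` on `Re s = 1`, all `v`, `L' ≥ ℒ'`, `0 < r`, `512r ≤ 1/8`, `rL' ≥ 1`: if `L₀(·, χ)` has a
  zero `ρ₀` with `|ρ₀ − (1 + iv)| ≤ r`, then for every natural `K' ≥ c₄ rL' + 2` there is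
  `k ∈ [K', 2K']` with `‖(L₀'/L₀)^{(k)}(1 + r + iv)‖/k! ≥ e^{−10K'} (2r)^{−(k+1)}`.

## References

* [Bombieri1987GrandCrible] E. Bombieri, Astérisque 18 (1987), §6 Lemme A, pp. 43–45.
* [ThornerZaman2017] J. Thorner, A. Zaman, Algebra Number Theory 11 (2017), §5.
-/

noncomputable section

open Complex Metric Set Filter Finset
open scoped Real Topology

namespace Literature.NumberTheory.LFunctions.NumberField

open Literature.NumberTheory.LFunctions.LogFreeLocal Literature.NumberTheory.LFunctions.LogFreeDensity
open scoped nonZeroDivisors _root_.NumberField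

variable {K : Type*} [Field K] [NumberField K]

variable (K) in
/-- The height of Lemme A: `ℒ' = (77760(5n+2) + 217440) · discBound K v`. [folklore] -/
def lemmaAHeight (v : ℝ) : ℝ :=
  (77760 * (5 * Module.finrank ℚ K + 2) + 217440) * discBound K v

/-- `discBound ≤ ℒ'` and `1 ≤ ℒ'`. [folklore] -/
theorem discBound_le_lemmaAHeight (v : ℝ) : discBound K v ≤ lemmaAHeight K v := by
  rw [lemmaAHeight]
  have h := one_le_discBound K v
  have : (1 : ℝ) ≤ 77760 * (5 * Module.finrank ℚ K + 2) + 217440 := by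
    have : (0 : ℝ) ≤ Module.finrank ℚ K := Nat.cast_nonneg _
    nlinarith
  nlinarith

/-- `1 ≤ ℒ'`. [folklore] -/
theorem one_le_lemmaAHeight (v : ℝ) : 1 ≤ lemmaAHeight K v :=
  (one_le_discBound K v).trans (discBound_le_lemmaAHeight v)

/-- **Lemme de densité for `L₀`**: for `0 < λ ≤ 1/4`,
`Σ_{|ρ−(1+iv)| ≤ λ} m(ρ) ≤ 4(1 + λℒ')`. [cite: Bombieri1987GrandCrible, §6 Lemme de densité] -/
theorem localCount_classGroupLFunction₀_le {χ : ClassGroup (𝓞 K) →* ℂˣ} (hχ : χ ≠ 1) (v : ℝ) {lam : ℝ}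
    (hlam : 0 < lam) (hlam4 : lam ≤ 1 / 4) :
    ∑ ρ ∈ (discZeros (classGroupLFunction₀ K χ) v).filter (fun ρ => ‖ρ - (1 + (v : ℂ) * I)‖ ≤ lam),
        (discDivisor (classGroupLFunction₀ K χ) v ρ : ℝ) ≤ 4 * (1 + lam * lemmaAHeight K v) := by
  set f := classGroupLFunction₀ K χ with hf
  set s : ℂ := ((1 + lam : ℝ) : ℂ) + (v : ℂ) * I with hs
  have hsre : s.re = 1 + lam := by simp [hs]
  have hs1 : 1 < s.re := by rw [hsre]; linarith
  have hs2 : s.re ≤ 2 := by rw [hsre]; linarith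
  have hsmem : s ∈ closedBall (2 + (v : ℂ) * I) (7 / 4) := by
    rw [mem_closedBall, dist_eq_norm]
    have : s - (2 + (v : ℂ) * I) = ((lam - 1 : ℝ) : ℂ) := by rw [hs]; push_cast; ring
    rw [this, Complex.norm_real, Real.norm_eq_abs, abs_of_nonpos (by linarith)]; linarith
  have hsne1 : s ≠ 1 := fun h ↦ by rw [h, one_re] at hs1; exact lt_irrefl _ hs1
  have hfs : f s ≠ 0 := by
    rw [hf, classGroupLFunction₀_eq χ hsne1 hχ]
    exact classGroupLFunction_ne_zero_of_one_lt_re K χ hs1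
  have hpf := norm_logDeriv_classGroupLFunction₀_sub_sum_le hχ v hsmem hfs
  have hld := norm_logDeriv_classGroupLFunction₀_le hχ hs1 hs2
  rw [hsre, show (1 : ℝ) + lam - 1 = lam by ring] at hld
  have hre : ∀ ρ ∈ discZeros f v, ρ.re ≤ 1 := by
    intro ρ hρ
    have h0 := ((mem_discZeros (differentiable_classGroupLFunction₀ χ) (classGroupLFunction₀_two_add_ne_zero hχ v)).1 hρ).2
    by_contra hgt
    rw [not_le] at hgt
    have hρ1 : ρ ≠ 1 := fun h ↦ by rw [h, one_re] at hgt; exact lt_irrefl _ hgt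
    rw [classGroupLFunction₀_eq χ hρ1 hχ] at h0
    exact classGroupLFunction_ne_zero_of_one_lt_re K χ hgt h0
  have h := sum_near_le (differentiable_classGroupLFunction₀ χ) hlam hre hpf hld
  refine h.trans ?_
  have hℓ := log_discr_add_log_four_le_discBound (K := K) v
  have hℒ := discBound_le_lemmaAHeight (K := K) v
  have hℒ0 : 0 ≤ discBound K v := le_trans zero_le_one (one_le_discBound K v)
  have hn : (0 : ℝ) ≤ Module.finrank ℚ K := Nat.cast_nonneg _
  have hK₀ : 0 ≤ 77760 * (5 * (Module.finrank ℚ K : ℝ) + 2) := by positivity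
  -- `4 + 4λ K₀ ℓ + 4λ E ≤ 4 + 4λ ℒ'`
  have key : 77760 * (5 * (Module.finrank ℚ K : ℝ) + 2) * (Real.log ((NumberField.discr K).natAbs : ℝ) + Real.log 4) +
      217440 * discBound K v ≤ lemmaAHeight K v := by
    rw [lemmaAHeight]
    nlinarith
  nlinarith

/-- **Bombieri's Lemme A for `L₀(s, χ)`, `χ ≠ 1`**, uniformly in the number field: there is an
absolute `c₄ > 0` such that for every number field `K`, every class group character `χ ≠ 1` whose
`L₀(s, χ)` does not vanish on `Re s ≥ 1`, all real `v` and `0 < r` with `512 r ≤ 1/8`, `rℒ' ≥ 1`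
(`ℒ' = lemmaAHeight K v`): if `L₀(·, χ)` has a zero `ρ₀` with `|ρ₀ − (1 + iv)| ≤ r`, then for every
natural `K' ≥ c₄ rℒ' + 2` there is `k ∈ [K', 2K']` with
`e^{−10K'} (2r)^{−(k+1)} ≤ ‖(L₀'/L₀)^{(k)}(1 + r + iv, χ)‖/k!`. [cite: Bombieri1987GrandCrible, §6 Lemme A] -/
theorem lemmeA_classGroup₀ :
    ∃ c₄ : ℝ, 0 < c₄ ∧ ∀ (K : Type*) [Field K] [NumberField K] (χ : ClassGroup (𝓞 K) →* ℂˣ), χ ≠ 1 →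
      (∀ ρ : ℂ, classGroupLFunction₀ K χ ρ = 0 → ρ.re < 1) →
      ∀ (v r L' : ℝ), lemmaAHeight K v ≤ L' → 0 < r → 512 * r ≤ 1 / 8 → 1 ≤ r * L' →
        (∃ ρ₀ : ℂ, classGroupLFunction₀ K χ ρ₀ = 0 ∧ ‖ρ₀ - (1 + (v : ℂ) * I)‖ ≤ r) →
        ∀ K' : ℕ, c₄ * (r * L') + 2 ≤ K' →
          ∃ k ∈ Finset.Icc K' (2 * K'),
            Real.exp (-(10 * K')) * (2 * r)⁻¹ ^ (k + 1) ≤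
              ‖iteratedDeriv k (logDeriv (classGroupLFunction₀ K χ)) (((1 + r : ℝ) : ℂ) + (v : ℂ) * I)‖ /
                k.factorial := by
  obtain ⟨c₄, hc₄, h⟩ := lemmeA_abstract (C_d := 4) (C_J := 1) (C₁ := 1) (by norm_num) one_pos one_pos
  refine ⟨c₄, hc₄, fun K _ _ χ hχ hline v r L' hL hr hr8 hu hzero K' hK' ↦ ?_⟩
  set f := classGroupLFunction₀ K χ with hf
  have hdf : Differentiable ℂ f := differentiable_classGroupLFunction₀ χ
  have hfc : f (2 + (v : ℂ) * I) ≠ 0 := classGroupLFunction₀_two_add_ne_zero hχ v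
  set s₀ : ℂ := ((1 + r : ℝ) : ℂ) + (v : ℂ) * I with hs₀
  have hr0 : r ≤ 1 / 4096 := by linarith
  have hs₀re : s₀.re = 1 + r := by simp [hs₀]
  have hs₀1 : 1 < s₀.re := by rw [hs₀re]; linarith
  have hs₀ne : s₀ ≠ 1 := fun h' ↦ by rw [h', one_re] at hs₀1; exact lt_irrefl _ hs₀1
  have hfs₀ : f s₀ ≠ 0 := by
    rw [hf, classGroupLFunction₀_eq χ hs₀ne hχ]
    exact classGroupLFunction_ne_zero_of_one_lt_re K χ hs₀1
  have hs₀mem : s₀ ∈ closedBall (2 + (v : ℂ) * I) (3 / 2) := by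
    rw [mem_closedBall, dist_eq_norm]
    have : s₀ - (2 + (v : ℂ) * I) = ((r - 1 : ℝ) : ℂ) := by rw [hs₀]; push_cast; ring
    rw [this, Complex.norm_real, Real.norm_eq_abs, abs_of_nonpos (by linarith)]; linarith
  have hℒ1 := one_le_lemmaAHeight (K := K) v
  have hℒd := discBound_le_lemmaAHeight (K := K) v
  have hL'0 : 0 ≤ L' := le_trans (le_trans zero_le_one hℒ1) hL
  refine h (discZeros f v) (discDivisor f v) (fun k ↦ iteratedDeriv k (logDeriv f) s₀) v r L'
    hr hr8 hu (fun ρ ↦ discDivisor_nonneg hdf v ρ) ?_ ?_ ?_ ?_ ?_ K' hK'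
  · -- `Re ρ < 1` and `m(ρ) ≥ 1`
    intro ρ hρ
    have hmem := (mem_discZeros hdf hfc).1 hρ
    exact ⟨hline ρ hmem.2, by exact_mod_cast one_le_discDivisor hdf hfc hρ⟩
  · -- Lemme de densité
    intro lam hlam hlam4
    refine (localCount_classGroupLFunction₀_le hχ v hlam hlam4).trans ?_
    have := mul_le_mul_of_nonneg_left hL hlam.le
    nlinarith
  · -- Jensen
    calc ∑ ρ ∈ discZeros f v, (discDivisor f v ρ : ℝ) ≤ 128 * discBound K v :=
          sum_discDivisor_classGroupLFunction₀_le hχ v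
      _ ≤ 1 * L' := by
          rw [one_mul]
          refine le_trans ?_ hL
          rw [lemmaAHeight]
          have hℒ0 : 0 ≤ discBound K v := le_trans zero_le_one (one_le_discBound K v)
          have hn : (0 : ℝ) ≤ Module.finrank ℚ K := Nat.cast_nonneg _
          nlinarith
  · -- Cauchy
    intro k
    have hpf : ∀ z ∈ closedBall (2 + (v : ℂ) * I) (7 / 4), f z ≠ 0 →
        ‖logDeriv f z - ∑ ρ ∈ discZeros f v, (discDivisor f v ρ : ℂ) / (z - ρ)‖ ≤ 217440 * discBound K v :=
      fun z hz hfz ↦ norm_logDeriv_classGroupLFunction₀_sub_sum_le hχ v hz hfz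
    have hE : (0 : ℝ) ≤ 217440 * discBound K v := by
      have := one_le_discBound K v; positivity
    have hC := norm_iteratedDeriv_logDeriv_sub_le hdf hfc hE hpf hs₀mem hfs₀ k
    refine hC.trans ?_
    have hfac : (0 : ℝ) ≤ k.factorial * 16 ^ k := by positivity
    calc (k.factorial : ℝ) * 16 ^ k * (217440 * discBound K v) ≤ k.factorial * 16 ^ k * (1 * L') := by
          refine mul_le_mul_of_nonneg_left ?_ hfac
          rw [one_mul]
          refine le_trans ?_ hL
          rw [lemmaAHeight]
          have hℒ0 : 0 ≤ discBound K v := le_trans zero_le_one (one_le_discBound K v)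
          have hn : (0 : ℝ) ≤ Module.finrank ℚ K := Nat.cast_nonneg _
          nlinarith
      _ = _ := by ring
  · -- the zero
    obtain ⟨ρ₀, hρ₀, hρ₀r⟩ := hzero
    refine ⟨ρ₀, (mem_discZeros hdf hfc).2 ⟨?_, hρ₀⟩, hρ₀r⟩
    rw [mem_closedBall, dist_eq_norm]
    calc ‖ρ₀ - (2 + (v : ℂ) * I)‖ = ‖(ρ₀ - (1 + (v : ℂ) * I)) + (-1 : ℂ)‖ := by ring_nf
      _ ≤ ‖ρ₀ - (1 + (v : ℂ) * I)‖ + ‖(-1 : ℂ)‖ := norm_add_le _ _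
      _ ≤ r + 1 := by rw [norm_neg, norm_one]; linarith
      _ ≤ 31 / 16 := by linarith

end Literature.NumberTheory.LFunctions.NumberField

end
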